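import Summits.BirchSwinnertonDyer.BirchSwinnertonDyer.Theorems.PrintX8VSOneColourMuAnX8
import Literature.NumberTheory.EllipticCurves.Rank1Residual.PeriodUnitProofs
import Literature.NumberTheory.EllipticCurves.Kato2004.DivisibilityInputsZetaLine
import Literature.NumberTheory.EllipticCurves.ModularCurvePeriodRatio
import HarnessLib

/-!
# Crux K1 `SprungLowerDivisibilityAtThree` (stmt-BirchSwinnertonDyer-19875), line `chromatic-common-zeros`,
# stub S3 `stub_periodMu` — PROVED (`--supports` 19875; closes nothing by itself)

Line `Cruxes/SprungLowerDivisibilityAtThree/Lines/chromatic_common_zeros.lean`, stub S3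
«`(3)` is never a common zero»: on an X8 pair (`p = 3`, good supersingular, `a₃ = ±3`; ANY image, ANY
rank), for a newform `f` of `W`, a period ratio `ϖ` (`ϖ · Ω_E = Ω⁺_f`) and ANY Sprung pair `(L♯, L♭)`,

* (i) every colour `•` has a NÉRON-NORMALISED integral function `G^• ∈ Λ` with `ι G^• = ϖ · ι L^•`
  (`ι = iwasawaToPowerSeries p`): the period ratio `ϖ` is a `3`-adic unit (the held period fact at `3`,
  binder `h3 : realPeriodRat_eq_unit_mul_plusPeriod_three`, read through
  `Rank1Residual.padicValRat_periodRatio_eq_zero_of_eq_unit_mul`), so `G^• := C(ϖ) · L^•` works;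
* (ii) for ONE colour `col₀`, `G^{col₀}` lies in NO height-one prime of `Λ = ℤ₃⟦T⟧` containing `3`:
  THEOREM B of the x8 cell (`PrintX8VSOneColourMuAnX8.ClassX8.oneColourMuAn`, input-free: one colour has
  unit content) and «a height-one prime containing `p` is `(p)`»
  (`Kato2004.eq_augIdealP_of_height_eq_one_of_C_mem`); a unit times an element of unit content is not in
  the prime `(p)` (`IwasawaAlgebra.isPrime_augIdealP_holds`, `GreenbergVatsal2000.hasUnitContent_iff_not_C_dvd`).

The statement `stub_periodMu` below is VERBATIM the stub of that name in the line file (namespace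
`…Cruxes.SprungLowerDivisibilityAtThree.ChromaticCommonZeros`), here under `…Theorems.ChromaticCommonZeros`.
CONDITIONAL on the named binder `h3` exactly as the stub is registered (the period unit at `3`,
Greenberg–Vatsal 2000 Rem. 3.4; in tree `SkinnerUrban2014.realPeriodRat_eq_unit_mul_plusPeriod_three_of_mazur`
derives it from Mazur's Manin-constant fact). IMAGE-FREE, RANK-FREE. K1 and BSD on leaf X8 are NOT proved
by this file; it is one of six stubs of one line.

References: [GreenbergVatsal2000] §3 Rem. 3.4; [Sprung2012] Main Thm. 6.12; [Sprung2017] Cor. 4.10,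
Thm. 1.12; [Pollack2003] Def. 6.15; [Washington1997] §13.1–13.2.
-/

set_option autoImplicit false
-- justification: the mandated namespace `Summit.BirchSwinnertonDyer.BirchSwinnertonDyer.Theorems`
-- (single-conjunct summit, Sub = Summit) repeats a segment by design (D-0017).
set_option linter.dupNamespace false

noncomputable section

open scoped Classical MatrixGroups ModularForm

open CongruenceSubgroup WeierstrassCurve
  Literature.NumberTheory.EllipticCurves Literature.NumberTheory.EllipticCurves.ModularForms
  Literature.NumberTheory.EllipticCurves.Sprung2017
  Literature.NumberTheory.EllipticCurves.Rank1Residual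
  Literature.NumberTheory.EllipticCurves.GreenbergVatsal2000
  Literature.NumberTheory.EllipticCurves.IwasawaAlgebra
  Summit.BirchSwinnertonDyer.BirchSwinnertonDyer.Theorems.PrintX8VSOneColourMuAnX8

namespace Summit.BirchSwinnertonDyer.BirchSwinnertonDyer.Theorems.ChromaticCommonZeros

/-! ### Algebra in `Λ = ℤ_p⟦T⟧` -/

/-- **Néron normalisation by a `p`-adic unit.** For `ϖ ∈ ℤ_p` and `L ∈ Λ`, the integral element
`C(ϖ) · L` maps to `C(ϖ) · ι L` in `ℚ_p⟦T⟧` (`ι` = coefficientwise `ℤ_p ↪ ℚ_p`). [folklore] -/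
theorem iwasawaToPowerSeries_C_mul {p : ℕ} [Fact p.Prime] (a : ℤ_[p]) (L : IwasawaAlgebra p) :
    iwasawaToPowerSeries p (PowerSeries.C a * L) =
      PowerSeries.C (a : ℚ_[p]) * iwasawaToPowerSeries p L := by
  rw [map_mul, PowerSeries.map_C, PadicInt.algebraMap_apply]

/-- **A unit multiple of an element of unit content misses every height-one prime above `p`.**
If `a ∈ ℤ_pˣ` and `L ∈ Λ` has unit content (`p ∤ L`), then `C(a) · L ∉ 𝔭` for every height-one prime
`𝔭 ∋ p` of `Λ = ℤ_p⟦T⟧` — such a `𝔭` is `(p)` (Washington §13.2), which is prime (§13.1).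
[cite: Washington1997, §13.1–13.2] [cite: GreenbergVatsal2000, p. 2, (2)] -/
theorem C_mul_notMem_of_height_eq_one_of_natCast_mem {p : ℕ} [Fact p.Prime] {a : ℤ_[p]}
    (ha : IsUnit a) {L : IwasawaAlgebra p} (hL : HasUnitContent L)
    (𝔭 : PrimeSpectrum (IwasawaAlgebra p)) (h1 : 𝔭.asIdeal.height = 1)
    (hp : (p : IwasawaAlgebra p) ∈ 𝔭.asIdeal) : PowerSeries.C a * L ∉ 𝔭.asIdeal := by
  have hp' : (PowerSeries.C (p : ℤ_[p]) : IwasawaAlgebra p) ∈ 𝔭.asIdeal := by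
    rwa [map_natCast]
  rw [Kato2004.eq_augIdealP_of_height_eq_one_of_C_mem 𝔭 h1 hp']
  intro hmem
  rcases (isPrime_augIdealP_holds p).mem_or_mem hmem with hC | hLmem
  · exact (isPrime_augIdealP_holds p).ne_top
      (Ideal.eq_top_of_isUnit_mem _ hC ((PowerSeries.C (R := ℤ_[p])).isUnit_map ha))
  · rw [hasUnitContent_iff_not_C_dvd] at hL
    exact hL (Ideal.mem_span_singleton.mp hLmem)

/-! ### The period ratio is a `3`-adic unit on class X8 -/

/-- **`ϖ ∈ ℤ₃ˣ` on class X8.** For `W` in class X8 (good at `3`, `E[3]` irreducible by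
`ClassX8.irr`), a newform `f` of `W` and `ϖ ∈ ℚ` with `ϖ · Ω_E = Ω⁺_f`, the held period fact at `3`
(`h3`) gives `ord₃ ϖ = 0` (`padicValRat_periodRatio_eq_zero_of_eq_unit_mul`), i.e. `‖ϖ‖₃ = 1`.
[cite: GreenbergVatsal2000, §3 Rem. 3.4] -/
theorem norm_periodRatio_eq_one_of_classX8 (h3 : realPeriodRat_eq_unit_mul_plusPeriod_three)
    (W : WeierstrassCurve ℚ) [W.IsElliptic] [W.IsGloballyMinimal] (p : ℕ) [Fact p.Prime]
    (hX : ClassX8 W p) {N : ℕ} [NeZero N] (f : CuspForm (Gamma0 N) 2) (hf : IsNewformOf W f)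
    (ϖ : ℚ) (hϖ : (ϖ : ℝ) * W.realPeriodRat = plusPeriod f) : ‖(ϖ : ℚ_[p])‖ = 1 := by
  have hp3 : p = 3 := hX.1
  subst hp3
  obtain ⟨u, hu, hΩ⟩ := h3 W hX.2.1.1 (ClassX8.irr W 3 hX) f hf
  have hv : padicValRat 3 ϖ = 0 := padicValRat_periodRatio_eq_zero_of_eq_unit_mul W 3 f hu hΩ ϖ hϖ
  have hϖ0 : ϖ ≠ 0 := by
    rintro rfl
    rw [Rat.cast_zero, zero_mul] at hϖ
    have hΩpos : 0 < W.realPeriodRat := W.realPeriodRat_pos_holds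
    rw [hΩ] at hΩpos
    have hplus : plusPeriod f ≠ 0 := fun h0 ↦ by rw [h0, mul_zero] at hΩpos; exact lt_irrefl _ hΩpos
    exact hplus hϖ.symm
  have hne : ((ϖ : ℚ) : ℚ_[3]) ≠ 0 := by exact_mod_cast hϖ0
  rw [Padic.norm_eq_zpow_neg_valuation hne, Padic.valuation_ratCast, hv, neg_zero, zpow_zero]

/-! ### Stub S3, verbatim -/

/-- **stub S3 of line `chromatic-common-zeros` — `(3)` is never a common zero — PROVED** (verbatim the
registered signature; modulo the held period unit `h3`): on an X8 pair, (i) both Néron-normalised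
`G^• = ϖ·L^• ∈ Λ` exist (`|ϖ|₃ = 1`, `norm_periodRatio_eq_one_of_classX8`, and `G^• := C(ϖ)·L^•`,
`iwasawaToPowerSeries_C_mul`), and (ii) for some colour `col₀`, `G^{col₀}` lies in no height-one prime
containing `3` — `L^{col₀}` has unit content by THEOREM B of the x8 cell (`ClassX8.oneColourMuAn`,
input-free: SPAN ∘ vertical Stevens ∘ Sprung 2017 Cor. 4.10 / Thm. 1.12), and `(3)` is the only
height-one prime containing `3` (`C_mul_notMem_of_height_eq_one_of_natCast_mem`). IMAGE-FREE, RANK-FREE.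
K1 / BSD are not proved by this. [cite: GreenbergVatsal2000, §3 Rem. 3.4] [cite: Sprung2017, Cor. 4.10, Thm. 1.12]
[cite: Pollack2003, Def. 6.15] [cite: Washington1997, §13.2] -/
theorem stub_periodMu (h3 : realPeriodRat_eq_unit_mul_plusPeriod_three) :
    ∀ (W : WeierstrassCurve ℚ) [W.IsElliptic] [W.IsGloballyMinimal] (p : ℕ) [Fact p.Prime],
      ClassX8 W p → ∀ (N : ℕ) (_ : NeZero N) (f : CuspForm (Gamma0 N) 2) (ϖ : ℚ)
        (Lsharp Lflat : IwasawaAlgebra p),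
      IsNewformOf W f → (ϖ : ℝ) * W.realPeriodRat = plusPeriod f →
      IsSprungPair f p (W.frobeniusTrace p) Lsharp Lflat →
      (∀ col : Chroma, ∃ G : IwasawaAlgebra p,
          iwasawaToPowerSeries p G =
            PowerSeries.C (ϖ : ℚ_[p]) * iwasawaToPowerSeries p (chromaticL col Lsharp Lflat)) ∧
      ∃ (col₀ : Chroma) (G₀ : IwasawaAlgebra p),
        iwasawaToPowerSeries p G₀ =
            PowerSeries.C (ϖ : ℚ_[p]) * iwasawaToPowerSeries p (chromaticL col₀ Lsharp Lflat) ∧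
        ∀ 𝔭 : PrimeSpectrum (IwasawaAlgebra p), 𝔭.asIdeal.height = 1 →
          (p : IwasawaAlgebra p) ∈ 𝔭.asIdeal → G₀ ∉ 𝔭.asIdeal := by
  intro W _ _ p _ hX N hN f ϖ Lsharp Lflat hf hϖ hSP
  haveI : NeZero N := hN
  -- the period ratio as an element of `ℤ_p`, a unit
  have hnorm : ‖(ϖ : ℚ_[p])‖ = 1 := norm_periodRatio_eq_one_of_classX8 h3 W p hX f hf ϖ hϖ
  set a : ℤ_[p] := ⟨(ϖ : ℚ_[p]), hnorm.le⟩ with ha_def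
  have ha : IsUnit a := PadicInt.isUnit_iff.mpr hnorm
  have hcoe : (a : ℚ_[p]) = (ϖ : ℚ_[p]) := rfl
  have hG : ∀ col : Chroma,
      iwasawaToPowerSeries p (PowerSeries.C a * chromaticL col Lsharp Lflat) =
        PowerSeries.C (ϖ : ℚ_[p]) * iwasawaToPowerSeries p (chromaticL col Lsharp Lflat) := fun col ↦ by
    rw [iwasawaToPowerSeries_C_mul, hcoe]
  refine ⟨fun col ↦ ⟨PowerSeries.C a * chromaticL col Lsharp Lflat, hG col⟩, ?_⟩
  -- THEOREM B: one colour with unit content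
  obtain ⟨col₀, -, -, hU, -⟩ := ClassX8.oneColourMuAn W p hX N hN f Lsharp Lflat hf hSP
  exact ⟨col₀, PowerSeries.C a * chromaticL col₀ Lsharp Lflat, hG col₀,
    fun 𝔭 h1 hp ↦ C_mul_notMem_of_height_eq_one_of_natCast_mem ha hU 𝔭 h1 hp⟩

end Summit.BirchSwinnertonDyer.BirchSwinnertonDyer.Theorems.ChromaticCommonZeros

end
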